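import Summits.QuantumFields.BalabanUV.Beta.GAN24.FibreRateTBlockLabel

/-!
# `BalabanUV.Beta.GAN24.FibreRateTBlockSum` — binder row G-an2-4 / (CONV-C), road P1-fibre, self-row **P1-Y11t\*** (sub-part of p1 row L11,
# division agreed with the L11 owner in CLAIMS l.3039/l.3094), part 4: THE TWO-LEVEL RATE OF THE T-SUM
# `𝔅_N := Σ_m N^{D−2}·tTerm(m)` — matched labels + new-label tail ⇒ `‖𝔅_{N·Lc} − 𝔅_N‖ ≤ C_T(D,Lc)/N²`

NOT IN PRINT; OUR PROOF ATTEMPT.  HONEST FRAMING (cell contract, verbatim): «discharging `BetaPertH` makes Bałaban's UV stability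
UNCONDITIONAL — a real constructive-QFT result; it is NOT the continuum limit and NOT the Clay problem.»  HONEST DEPENDENCY (verbatim):
«continuum YM on T⁴ ⇐ BetaPertH ∧ nine spine estimates (0/9 proved); BetaPertH ⇐ (D1) ∧ (D4) ∧ CAP+tail; G-an2-4 gates asym, D1 and
NE2/3/4.»  [folklore] the split of row Y11d `AliasReindex.norm_sum_sub_sum_le_of_rates` fed with part 3's per-label rate/bound, the
label sum bounded through King's alias majorant (`King1986.AliasSums.aliasMaj`, `AliasTail.sum_aliasMaj_le_colConst` BY NAME); two
displayed-constant `def`s (`coordConst`, `tConst`); NO cited fact, NO `def … : Prop`, NO wall binder, NO unit re-typed (the unit `N^{D−2}` is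
DISPLAYED; at `d = 3` p1 row L11 multiplies by `sfStep Lc j ² = (Lc^j)²` BY NAME: `sf_j²·Σ_m tTerm = Lc⁻²·𝔅_N`, c1/c3).
NOT summit progress; nothing of (CONV-C)'s K-slot is discharged here.

## What is proved (real `pr ∈ [−π,π]^D`, `N = M·Lc ≥ 2`, `M, Lc ≥ 1`; next level `(N·Lc, N)`)
* §1 the per-coordinate LABEL SUM `Σ_{r ∈ ℤ/N} wMaj Lc (p + 2π·valMinAbs r) ≤ coordConst Lc := max(1, 144Lc²/π)·colConst 2` uniformly in
  `N` and `p` (`wMaj ≤ max(1,144Lc²/π)·aliasMaj 2 p n`, King (4.22)); the `D`-fold sum `Σ_{m} Π_i wMaj Lc (qlab pr m i) ≤ coordConst Lc ^ D`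
  (`Finset.prod_univ_sum`).
* §2 NEW LABELS have a large coordinate: `momSq (qlab pr m′) ≥ N²` (`AliasReindex.exists_coord_of_mem_newLabels`), hence the TAIL
  `Σ_{m′ ∈ newLabels} ‖tNorm_{N·Lc,N}(m′)‖ ≤ 666·coordConst Lc^D/N²`.
* §3 **`norm_tSum_two_level_le`**: with `tSum N M pr κ l x′ y′ := Σ_m tNorm N M pr m κ l x′ y′` (= `N^{D−2}·Σ_m tTerm`),
  `‖tSum (N·Lc) N − tSum N M‖ ≤ tConst Lc D / N²`, `tConst Lc D := 284814·coordConst Lc ^ D`, for EVERY real `pr ∈ [−π,π]^D` (the origin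
  included: the rate is `p`-uniform); the STEP form `norm_tSum_step_le` at `N = Lc^{j+1}`, `M = Lc^j`: `≤ tConst/((Lc^{j+1})²)` — the
  L11 owner recognises `θ = Lc⁻²` and the unit (c1).
-/

noncomputable section

open Complex Finset
open scoped BigOperators Real
open Literature.Probability.LatticeModels (TorusSite)
open Literature.MathematicalPhysics.QuantumFieldTheory.King1986 (latticeSymbol momSq momSq_nonneg aliasMaj aliasMaj_nonneg pi_le_abs_add)
open Literature.MathematicalPhysics.QuantumFieldTheory.Balaban1983to89.B4Strip (ofRealVec)
open Summit.QuantumFields.BalabanUV.Beta.GAN24.AliasReindex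
  (srep lift newLabels srep_lift natAbs_srep_le exists_coord_of_mem_newLabels norm_sum_sub_sum_le_of_rates)
open Summit.QuantumFields.BalabanUV.Beta.GAN24.FibreRateTBlock (qlab)
open Summit.QuantumFields.BalabanUV.Beta.GAN24.FibreRateTBlockRate (wMaj wMaj_nonneg wMaj_le_one wMaj_le_div)
open Summit.QuantumFields.BalabanUV.Beta.GAN24.FibreRateTBlockLabel (tNorm norm_tNorm_le norm_tNorm_two_level_le)

namespace Summit.QuantumFields.BalabanUV.Beta.GAN24.FibreRateTBlockSum

variable {D : ℕ}

/-! ## §1 The label sums -/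

/-- [folklore] The per-coordinate label-sum constant `max(1, 144Lc²/π)·colConst 2` (`colConst 2 = 1 + 4/π`). -/
def coordConst (Lc : ℕ) : ℝ := max 1 (144 * (Lc : ℝ) ^ 2 / π) * AliasTail.colConst 2

/-- [folklore] `1 ≤ coordConst`. -/
theorem one_le_coordConst (Lc : ℕ) : 1 ≤ coordConst Lc := by
  unfold coordConst
  have h1 : (1 : ℝ) ≤ max 1 (144 * (Lc : ℝ) ^ 2 / π) := le_max_left _ _
  have h2 := AliasTail.one_le_colConst (s := 2) (by norm_num)
  nlinarith

/-- [folklore] `wMaj Lc (p + 2πn) ≤ max(1, 144Lc²/π)·aliasMaj 2 p n` (`|p| ≤ π`; `n = 0`: `≤ 1`; `n ≠ 0`: `|q| ≥ π ≥ 1`, `144Lc²/q² = (144Lc²/π)·π|q|⁻²`). -/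
theorem wMaj_le_aliasMaj (Lc : ℕ) {p : ℝ} (hp : |p| ≤ π) (n : ℤ) :
    wMaj Lc (p + 2 * π * n) ≤ max 1 (144 * (Lc : ℝ) ^ 2 / π) * aliasMaj 2 p n := by
  have hπ := Real.pi_pos
  unfold aliasMaj
  split_ifs with hn
  · rw [mul_one]; exact (wMaj_le_one _ _).trans (le_max_left _ _)
  · have hq : π ≤ |p + 2 * π * n| := pi_le_abs_add hp hn
    have hq1 : 1 ≤ (p + 2 * π * n) ^ 2 := by
      rw [← sq_abs]; nlinarith [Real.pi_gt_three]
    have hrpow : |p + 2 * π * (n : ℝ)| ^ (-(2 : ℝ)) = ((p + 2 * π * n) ^ 2)⁻¹ := by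
      rw [Real.rpow_neg (abs_nonneg _), Real.rpow_two, sq_abs]
    rw [hrpow]
    calc wMaj Lc (p + 2 * π * n) ≤ 144 * (Lc : ℝ) ^ 2 / (p + 2 * π * n) ^ 2 := wMaj_le_div hq1
      _ = 144 * (Lc : ℝ) ^ 2 / π * (π * ((p + 2 * π * n) ^ 2)⁻¹) := by field_simp
      _ ≤ max 1 (144 * (Lc : ℝ) ^ 2 / π) * (π * ((p + 2 * π * n) ^ 2)⁻¹) :=
          mul_le_mul_of_nonneg_right (le_max_right _ _) (by positivity)

/-- [folklore] **THE PER-COORDINATE LABEL SUM**: `Σ_{r ∈ ℤ/N} wMaj Lc (p + 2π·valMinAbs r) ≤ coordConst Lc`, uniformly in `N ≥ 1` and `|p| ≤ π`. -/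
theorem sum_wMaj_le (Lc N : ℕ) [NeZero N] {p : ℝ} (hp : |p| ≤ π) :
    ∑ r : ZMod N, wMaj Lc (p + 2 * π * ((r.valMinAbs : ℤ) : ℝ)) ≤ coordConst Lc := by
  classical
  -- reindex through the injective `valMinAbs` into the window `[−N, N]`
  have hinj : Set.InjOn (ZMod.valMinAbs : ZMod N → ℤ) (Finset.univ : Finset (ZMod N)) := fun a _ b _ h => ZMod.valMinAbs_inj.1 h
  have hsub : Finset.univ.image (ZMod.valMinAbs : ZMod N → ℤ) ⊆ Finset.Icc (-(N : ℤ)) N := by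
    intro n hn
    obtain ⟨r, -, rfl⟩ := Finset.mem_image.1 hn
    have h := ZMod.natAbs_valMinAbs_le r
    rw [Finset.mem_Icc]
    have h2 : (r.valMinAbs.natAbs : ℤ) ≤ N := by exact_mod_cast h.trans (Nat.div_le_self N 2)
    constructor <;> omega
  calc ∑ r : ZMod N, wMaj Lc (p + 2 * π * ((r.valMinAbs : ℤ) : ℝ))
      = ∑ n ∈ Finset.univ.image (ZMod.valMinAbs : ZMod N → ℤ), wMaj Lc (p + 2 * π * (n : ℝ)) :=
        (Finset.sum_image (f := fun n : ℤ => wMaj Lc (p + 2 * π * (n : ℝ))) hinj).symm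
    _ ≤ ∑ n ∈ Finset.Icc (-(N : ℤ)) N, wMaj Lc (p + 2 * π * (n : ℝ)) :=
        Finset.sum_le_sum_of_subset_of_nonneg hsub fun n _ _ => wMaj_nonneg _ _
    _ ≤ ∑ n ∈ Finset.Icc (-(N : ℤ)) N, max 1 (144 * (Lc : ℝ) ^ 2 / π) * aliasMaj 2 p n := Finset.sum_le_sum fun n _ => wMaj_le_aliasMaj Lc hp n
    _ = max 1 (144 * (Lc : ℝ) ^ 2 / π) * ∑ n ∈ Finset.Icc (-(N : ℤ)) N, aliasMaj 2 p n := by rw [Finset.mul_sum]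
    _ ≤ max 1 (144 * (Lc : ℝ) ^ 2 / π) * AliasTail.colConst 2 :=
        mul_le_mul_of_nonneg_left (AliasTail.sum_aliasMaj_le_colConst (by norm_num) hp N) (le_trans zero_le_one (le_max_left _ _))
    _ = coordConst Lc := rfl

/-- [folklore] **THE `D`-FOLD LABEL SUM**: `Σ_{m ∈ (ℤ/N)^D} Π_i wMaj Lc (qlab pr m i) ≤ coordConst Lc ^ D` (product structure, `Finset.prod_univ_sum`). -/
theorem sum_prod_wMaj_le (Lc N : ℕ) [NeZero N] {pr : Fin D → ℝ} (hpr : ∀ i, |pr i| ≤ π) :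
    ∑ m : TorusSite D N, ∏ i, wMaj Lc (qlab pr m i) ≤ coordConst Lc ^ D := by
  have h := Finset.prod_univ_sum (fun _ : Fin D => (Finset.univ : Finset (ZMod N)))
    (fun i (r : ZMod N) => wMaj Lc (pr i + 2 * π * ((r.valMinAbs : ℤ) : ℝ)))
  rw [Fintype.piFinset_univ] at h
  have e : ∑ m : TorusSite D N, ∏ i, wMaj Lc (qlab pr m i) = ∏ i : Fin D, ∑ r : ZMod N, wMaj Lc (pr i + 2 * π * ((r.valMinAbs : ℤ) : ℝ)) := by
    rw [h]; rfl
  rw [e]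
  calc ∏ i : Fin D, ∑ r : ZMod N, wMaj Lc (pr i + 2 * π * ((r.valMinAbs : ℤ) : ℝ)) ≤ ∏ _i : Fin D, coordConst Lc :=
        Finset.prod_le_prod (fun i _ => Finset.sum_nonneg fun r _ => wMaj_nonneg _ _) fun i _ => sum_wMaj_le Lc N (hpr i)
    _ = coordConst Lc ^ D := by rw [Finset.prod_const, Finset.card_univ, Fintype.card_fin]

/-! ## §2 The new labels: a large coordinate, the tail -/

/-- [folklore] A NEW LABEL has `momSq (qlab pr m′) ≥ N²` (`N ≤ 2|srep m′ i|` for some `i`, `|pr_i| ≤ π`, `N ≥ 2`: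
`|q_i| ≥ 2π|srep| − π ≥ πN − π ≥ N`). -/
theorem sq_le_momSq_of_mem_newLabels {N N' : ℕ} [NeZero N'] (hN2 : 2 ≤ N) {pr : Fin D → ℝ} (hpr : ∀ i, |pr i| ≤ π)
    {m' : TorusSite D N'} (hm' : m' ∈ (newLabels N N' : Finset (TorusSite D N'))) : (N : ℝ) ^ 2 ≤ momSq (qlab pr m') := by
  obtain ⟨i, hi⟩ := exists_coord_of_mem_newLabels hm'
  have hπ := Real.pi_gt_three
  have hN' : (2 : ℝ) ≤ N := by exact_mod_cast hN2
  have hs : (N : ℝ) ≤ 2 * |((srep m' i : ℤ) : ℝ)| := by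
    rw [← Int.cast_abs]; exact_mod_cast hi
  have hq : (N : ℝ) ≤ |qlab pr m' i| := by
    unfold qlab
    have h1 : |2 * π * ((srep m' i : ℤ) : ℝ)| - |pr i| ≤ |pr i + 2 * π * ((srep m' i : ℤ) : ℝ)| := by
      have := abs_sub_abs_le_abs_sub (2 * π * ((srep m' i : ℤ) : ℝ)) (-pr i)
      rw [abs_neg, sub_neg_eq_add, add_comm] at this
      exact this
    rw [abs_mul, abs_of_pos (by positivity : (0:ℝ) < 2 * π)] at h1
    have h2 : π * N - π ≤ 2 * π * |((srep m' i : ℤ) : ℝ)| - |pr i| := by nlinarith [hpr i, abs_nonneg (((srep m' i : ℤ) : ℝ))]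
    nlinarith
  have hsq : (N : ℝ) ^ 2 ≤ qlab pr m' i ^ 2 := by
    rw [← sq_abs (qlab pr m' i)]; exact pow_le_pow_left₀ (by positivity) hq 2
  exact hsq.trans (Finset.single_le_sum (fun j _ => sq_nonneg (qlab pr m' j)) (Finset.mem_univ i))

/-- [folklore] **THE TAIL**: `Σ_{m′ ∈ newLabels N (N·Lc)} ‖tNorm_{N·Lc,N}(m′)‖ ≤ 666·coordConst Lc^D/N²`. -/
theorem tail_le {N Lc : ℕ} [NeZero N] [NeZero (N * Lc)] (hN2 : 2 ≤ N) (hLc : 0 < Lc)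
    {pr : Fin D → ℝ} (hpr : ∀ i, |pr i| ≤ π) (κ l : Fin D) (x' y' : Fin D → ℤ) :
    ∑ m' ∈ newLabels N (N * Lc), ‖tNorm (N * Lc) N pr m' κ l x' y'‖ ≤ 666 * coordConst Lc ^ D / (N : ℝ) ^ 2 := by
  have hN : 0 < N := by omega
  have hN2' : 2 ≤ N * Lc := le_trans hN2 (Nat.le_mul_of_pos_right N hLc)
  have hNr : (0 : ℝ) < (N : ℝ) ^ 2 := by positivity
  have hterm : ∀ m' ∈ newLabels N (N * Lc), ‖tNorm (N * Lc) N pr m' κ l x' y'‖ ≤ 666 / (N : ℝ) ^ 2 * ∏ i, wMaj Lc (qlab pr m' i) := by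
    intro m' hm'
    have hmom := sq_le_momSq_of_mem_newLabels hN2 hpr hm'
    have hq0 : qlab pr m' ≠ 0 := by
      intro h; rw [h] at hmom; simp [momSq] at hmom; nlinarith
    have hb := norm_tNorm_le hN2' hN hLc rfl hpr m' hq0 κ l x' y'
    have hW : 0 ≤ ∏ i, wMaj Lc (qlab pr m' i) := Finset.prod_nonneg fun i _ => wMaj_nonneg _ _
    calc ‖tNorm (N * Lc) N pr m' κ l x' y'‖ ≤ 666 * (∏ i, wMaj Lc (qlab pr m' i)) / momSq (qlab pr m') := hb
      _ ≤ 666 * (∏ i, wMaj Lc (qlab pr m' i)) / (N : ℝ) ^ 2 := div_le_div_of_nonneg_left (by positivity) hNr hmom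
      _ = 666 / (N : ℝ) ^ 2 * ∏ i, wMaj Lc (qlab pr m' i) := by ring
  calc ∑ m' ∈ newLabels N (N * Lc), ‖tNorm (N * Lc) N pr m' κ l x' y'‖
      ≤ ∑ m' ∈ newLabels N (N * Lc), 666 / (N : ℝ) ^ 2 * ∏ i, wMaj Lc (qlab pr m' i) := Finset.sum_le_sum hterm
    _ ≤ ∑ m' : TorusSite D (N * Lc), 666 / (N : ℝ) ^ 2 * ∏ i, wMaj Lc (qlab pr m' i) :=
        Finset.sum_le_sum_of_subset_of_nonneg (Finset.subset_univ _) fun m' _ _ =>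
          mul_nonneg (by positivity) (Finset.prod_nonneg fun i _ => wMaj_nonneg _ _)
    _ = 666 / (N : ℝ) ^ 2 * ∑ m' : TorusSite D (N * Lc), ∏ i, wMaj Lc (qlab pr m' i) := by rw [Finset.mul_sum]
    _ ≤ 666 / (N : ℝ) ^ 2 * coordConst Lc ^ D := mul_le_mul_of_nonneg_left (sum_prod_wMaj_le Lc (N * Lc) hpr) (by positivity)
    _ = 666 * coordConst Lc ^ D / (N : ℝ) ^ 2 := by ring

/-! ## §3 The T-sum and its two-level rate -/

/-- [folklore] THE NORMALISED T-SUM `tSum N M pr κ l x′ y′ := Σ_m tNorm N M pr m κ l x′ y′` (`= N^{D−2}·Σ_m tTerm`). -/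
def tSum (N M : ℕ) [NeZero N] (pr : Fin D → ℝ) (κ l : Fin D) (x' y' : Fin D → ℤ) : ℂ := ∑ m : TorusSite D N, tNorm N M pr m κ l x' y'

/-- [folklore] The displayed rate constant `284814·coordConst Lc ^ D`. -/
def tConst (Lc D : ℕ) : ℝ := 284814 * coordConst Lc ^ D

/-- [folklore] `0 ≤ tConst`. -/
theorem tConst_nonneg (Lc D : ℕ) : 0 ≤ tConst Lc D := by
  unfold tConst; have := one_le_coordConst Lc; positivity

/-- [folklore] **THE TWO-LEVEL RATE OF THE T-SUM**: `‖tSum (N·Lc) N − tSum N M‖ ≤ tConst Lc D/N²` for `N = M·Lc ≥ 2`, `M, Lc ≥ 1`, every real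
`pr ∈ [−π,π]^D` (matched labels by part 3 + the tail of §2, through `AliasReindex.norm_sum_sub_sum_le_of_rates`). -/
theorem norm_tSum_two_level_le {N M Lc : ℕ} [NeZero N] [NeZero (N * Lc)] (hN2 : 2 ≤ N) (hM : 0 < M) (hLc : 0 < Lc) (hNM : N = M * Lc)
    {pr : Fin D → ℝ} (hpr : ∀ i, |pr i| ≤ π) (κ l : Fin D) (x' y' : Fin D → ℤ) :
    ‖tSum (N * Lc) N pr κ l x' y' - tSum N M pr κ l x' y'‖ ≤ tConst Lc D / (N : ℝ) ^ 2 := by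
  have hNLc : N ≤ N * Lc := Nat.le_mul_of_pos_right N hLc
  unfold tSum
  have h := norm_sum_sub_sum_le_of_rates hNLc (fun m => tNorm N M pr m κ l x' y') (fun m' => tNorm (N * Lc) N pr m' κ l x' y')
    (fun m => 284148 * (∏ i, wMaj Lc (qlab pr m i)) / (N : ℝ) ^ 2)
    (fun m => norm_tNorm_two_level_le hN2 hM hLc hNM hpr m κ l x' y') (tail_le hN2 hLc hpr κ l x' y')
  refine h.trans ?_
  have hS := sum_prod_wMaj_le Lc N hpr
  calc ∑ m : TorusSite D N, 284148 * (∏ i, wMaj Lc (qlab pr m i)) / (N : ℝ) ^ 2 + 666 * coordConst Lc ^ D / (N : ℝ) ^ 2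
      = (284148 * ∑ m : TorusSite D N, ∏ i, wMaj Lc (qlab pr m i) + 666 * coordConst Lc ^ D) / (N : ℝ) ^ 2 := by
        rw [Finset.mul_sum, ← Finset.sum_div, add_div]
    _ ≤ (284148 * coordConst Lc ^ D + 666 * coordConst Lc ^ D) / (N : ℝ) ^ 2 := by gcongr
    _ = tConst Lc D / (N : ℝ) ^ 2 := by unfold tConst; ring

/-- [folklore] **STEP FORM** (`N = Lc^{j+1}`, `M = Lc^j`, `Lc ≥ 2`): `‖tSum (Lc^{j+2}) (Lc^{j+1}) − tSum (Lc^{j+1}) (Lc^j)‖ ≤ tConst Lc D/(Lc^{j+1})²`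
— the L11 owner multiplies by the unit and recognises `θ = Lc⁻²` (TRIGGER-P1 c1/c3). -/
theorem norm_tSum_step_le {Lc : ℕ} [NeZero Lc] (hLc2 : 2 ≤ Lc) (j : ℕ) {pr : Fin D → ℝ} (hpr : ∀ i, |pr i| ≤ π)
    (κ l : Fin D) (x' y' : Fin D → ℤ) :
    ‖tSum (Lc ^ (j + 2)) (Lc ^ (j + 1)) pr κ l x' y' - tSum (Lc ^ (j + 1)) (Lc ^ j) pr κ l x' y'‖ ≤
      tConst Lc D / ((Lc : ℝ) ^ (j + 1)) ^ 2 := by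
  have hLc : 0 < Lc := by omega
  have hN2 : 2 ≤ Lc ^ (j + 1) := le_trans hLc2 (by
    calc Lc = Lc ^ 1 := (pow_one Lc).symm
      _ ≤ Lc ^ (j + 1) := Nat.pow_le_pow_right hLc (by omega))
  haveI : NeZero (Lc ^ (j + 1) * Lc) := ⟨by positivity⟩
  have h := norm_tSum_two_level_le (N := Lc ^ (j + 1)) (M := Lc ^ j) (Lc := Lc) hN2 (by positivity) hLc (by ring) hpr κ l x' y'
  have hcast : ((Lc ^ (j + 1) : ℕ) : ℝ) = (Lc : ℝ) ^ (j + 1) := by push_cast; ring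
  rw [hcast] at h
  exact h

end Summit.QuantumFields.BalabanUV.Beta.GAN24.FibreRateTBlockSum

end
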